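import Mathlib
import HarnessLib
import Literature.Analysis.FluidPDE.ClassicalSolution
import Literature.Analysis.FluidPDE.ClassicalSolutionRescale
import Literature.Analysis.FluidPDE.ForcedOseenRepresentationPointwise
import Literature.Analysis.FluidPDE.KNSSTypeIRateMildProofs
import Literature.Analysis.FluidPDE.AncientMildCompactness
import Literature.Analysis.FluidPDE.TypeIAncientMild
import Literature.Analysis.FluidPDE.LocalTypeIBlowup.SingularVertexZoom
import Summits.NavierStokesRegularity.NavierStokesRegularity.Theorems.QuarterLogPincerThinCascadeDefs
import Summits.NavierStokesRegularity.NavierStokesRegularity.Theorems.QuarterLogPincerTypeIQuantSubcubicExpFrameTools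

/-!
# Crux `QuarterLogPincer.TypeIQuantSubcubicExp` (stmt-NavierStokesRegularity-24077), line `thin_cascade`:
  the KNSS HALF of STUB `stub_thinObjectExtraction` — cheap cascades of every length have a
  Type-I ancient mild ZOOM LIMIT

Helper file (`--supports stmt-NavierStokesRegularity-24077 --as helper`, lead prover ns-tc-p1) toward the
registered stub `stub_thinObjectExtraction` of `Cruxes/TypeIQuantSubcubicExp/Lines/thin_cascade.lean`
(v4 `972f24fcf0c3`), whose plan begins: "recentre and rescale,
`v_K(y,s) := ρ_K u_K(x₀^K + ρ_K y, T_K + ρ_K² s)` on `s ∈ [−e^{2K}, 0]`; the virtual Type-I clause gives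
`‖v_K(y,s)‖ ≤ M/√(−s)` …, so KNSS 2009 (§4, Lemma 6.1) slab compactness of bounded mild solutions gives
a subsequence converging locally smoothly on `s < 0` to a limit in the Oseen gauge,
`IsTypeIAncientMild M v`."  This file proves exactly that part, BY NAME from the tree:

* `zoom_of_cheapCascade` — ONE cheap cascade `(T, τ, ρ, x₀, u, p)` of length `K` (Tao frame on
  `[0,T]`, `τ > 0`, `e^{2K}ρ² ≤ T`, virtual Type-I bound with constant `M`) zoomed at its centre and
  base scale, `w = ρ • stPull (ρ²) ρ T x₀ u` (`w(s,y) = ρ u(T + ρ²s, x₀ + ρy)`), is on the slab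
  `(−e^{2K}, 0) × ℝ³`: continuous, weakly divergence free, OSEEN-MILD between every pair of times
  (the Tao frame has finite energy and the virtual Type-I bound makes `u` bounded on `[0,T]`, so the
  tree's `IsClassicalNSSolutionOn.eq_forced_oseenMild_of_bounded` applies WITHOUT any pressure
  hypothesis; the identity is transported by `oseen_smul_stPull`), and has the honest rate
  `√(−s)‖w(s,y)‖ ≤ M` (the virtual remaining time only helps);
* `singularAt_zero_of_isBackwardSingularPoint` — glue for clause (3) of `ThinObject`: the tree's
  `IsBackwardSingularPoint v (0,0)` (the output of `LocalTypeIBlowup.local_typeI_compactness_singular`)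
  implies the line's `SingularAt v 0`;
* `exists_typeIAncientMild_zoomLimit_of_cheapCascades` — cheap cascades of EVERY length (the
  hypothesis of the stub, `∀ K, CheapCascade M q K`) have, along a subsequence of any choice of
  witnesses, a zoom limit `W` in the tree's class `IsTypeIAncientMild M W`, reached uniformly on the
  compact slab pieces, pointwise on the open past and locally uniformly on every negative slice
  (`KNSS2009_lemma61_typeI_rate` + `LocalTypeIBlowup.isTypeIAncientMild_of_continuous_oseenMild_rate`).
  The chosen cascade witnesses are exported with all their clauses (centre values
  `ρ_K‖u_K(T_K,x₀^K)‖ ≥ e^K` and final-time annular budgets), for the remaining half of the stub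
  (singularity persistence, final-time trace and its budget), which is NOT proved here.

HONEST FRAMING: this is clause (1) of `ThinObject` for the zoom limit only; clauses (2)–(6)
(uniform local energy, `SingularAt`, trace, budget) are open and hinge on a scaled local-energy bound
for sup-rate Type-I solutions that the tree does not have (see the item's evidence
`S2-INVENTORY-thin_cascade.md`).  No statement about Navier–Stokes regularity and no summit statement
is proved by this file.
-/

noncomputable section

-- the summit-side namespace `Summit.NavierStokesRegularity.NavierStokesRegularity.…` (single-conjunct summit,
-- D-0017) repeats a component by design; the dupNamespace linter would flag every declaration.
set_option linter.dupNamespace false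

namespace Summit.NavierStokesRegularity.NavierStokesRegularity.Theorems.ThinCascade

open MeasureTheory Set Function Filter Topology Metric
open scoped ENNReal NNReal
open Literature.Analysis Literature.Analysis.FluidPDE
open Summit.NavierStokesRegularity.NavierStokesRegularity.Cruxes.TypeIQuantSubcubicExp.ThinCascade

/-! ### Small facts -/

/-- The Duhamel force term of the zero force vanishes. [folklore] -/
theorem forceDuhamel_zero_force (ν s t : ℝ) (x : EuclideanSpace ℝ (Fin 3)) :
    forceDuhamel ν s (0 : ℝ → EuclideanSpace ℝ (Fin 3) → EuclideanSpace ℝ (Fin 3)) t x = 0 := by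
  have h0 : ∀ σ : ℝ,
      UnboundedOperators.heatExtension (0 : EuclideanSpace ℝ (Fin 3) → EuclideanSpace ℝ (Fin 3)) σ = 0 :=
    fun σ => UnboundedOperators.heatExtension_zero_fun σ
  simp [forceDuhamel_apply, h0]

/-- The zero field is weakly divergence free. [folklore] -/
theorem isWeaklyDivFree_zero_field :
    IsWeaklyDivFree (0 : EuclideanSpace ℝ (Fin 3) → EuclideanSpace ℝ (Fin 3)) :=
  fun θ _ => by simp

/-- `−e^{2k} → −∞`. [folklore] -/
theorem tendsto_neg_exp_two_mul_atBot :
    Tendsto (fun k : ℕ => -Real.exp (2 * (k : ℝ))) atTop atBot := by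
  refine tendsto_neg_atTop_atBot.comp (Real.tendsto_exp_atTop.comp ?_)
  exact (tendsto_natCast_atTop_atTop.const_mul_atTop (by norm_num : (0 : ℝ) < 2))

/-- The Tao frame has finite energy: `∫ ‖u(t)‖² ≤ C₀²` on `[0,T]` (the `H⁰` clause). [folklore] -/
theorem frame_finite_energy {T : ℝ}
    {u : ℝ → EuclideanSpace ℝ (Fin 3) → EuclideanSpace ℝ (Fin 3)}
    (hH : ∀ n : ℕ, ∃ C : NNReal, ∀ t ∈ Icc 0 T, eLpNorm (iteratedFDeriv ℝ n (u t)) 2 volume ≤ C) :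
    ∃ C : ℝ≥0∞, C < ⊤ ∧ ∀ t ∈ Icc 0 T, ∫⁻ x, ‖u t x‖ₑ ^ 2 ≤ C := by
  obtain ⟨C₀, hC₀⟩ := hH 0
  refine ⟨(C₀ : ℝ≥0∞) ^ 2, ENNReal.pow_lt_top ENNReal.coe_lt_top, fun t ht => ?_⟩
  have h0 : eLpNorm (u t) 2 volume = eLpNorm (iteratedFDeriv ℝ 0 (u t)) 2 volume :=
    eLpNorm_congr_norm_ae (Eventually.of_forall fun x => (norm_iteratedFDeriv_zero (𝕜 := ℝ)).symm)
  have h2 : ∫⁻ x, ‖u t x‖ₑ ^ 2 = eLpNorm (u t) 2 volume ^ 2 := by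
    have := eLpNorm_nnreal_pow_eq_lintegral (f := u t) (μ := volume) (p := 2) two_ne_zero
    rw [← ENNReal.rpow_two]
    push_cast at this
    rw [this]
    refine lintegral_congr fun x => ?_
    rw [← ENNReal.rpow_natCast]; norm_num
  rw [h2]
  exact pow_le_pow_left' (h0 ▸ hC₀ t ht) 2

/-! ### One cheap cascade, zoomed -/

/-- **The zoom of ONE cheap cascade** at its centre and base scale,
`w(s,y) = ρ u(T + ρ²s, x₀ + ρy)` (`= ρ • stPull (ρ²) ρ T x₀ u`), lives on the slab `(−e^{2K}, 0) × ℝ³`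
(backward life `e^{2K}ρ² ≤ T`) where it is continuous, weakly divergence free, Oseen-mild between every
pair of times, and has the rate `√(−s)‖w(s,y)‖ ≤ M` (virtual Type-I bound with remaining time `τ > 0`).
The Oseen identity comes from the tree's forced Oseen representation of bounded finite-energy classical
solutions (`IsClassicalNSSolutionOn.eq_forced_oseenMild_of_bounded`, zero force) transported by the
zoom covariance `oseen_smul_stPull`. [cite: KochNadirashviliSereginSverak2009, §6 (6.2) and Lemma 6.1 (arXiv:0709.3599 pp. 11–13)] -/
theorem zoom_of_cheapCascade {M T τ ρ : ℝ} {K : ℕ} (x₀ : EuclideanSpace ℝ (Fin 3))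
    {u : ℝ → EuclideanSpace ℝ (Fin 3) → EuclideanSpace ℝ (Fin 3)}
    {p : ℝ → EuclideanSpace ℝ (Fin 3) → ℝ}
    (hframe : IsClassicalNSSolutionOn (Icc 0 T) 1 0 u p ∧
      ∀ n : ℕ, ∃ C : NNReal, ∀ t ∈ Icc 0 T, eLpNorm (iteratedFDeriv ℝ n (u t)) 2 volume ≤ C)
    (hτ : 0 < τ) (hρ : 0 < ρ) (hlife : Real.exp (2 * K) * ρ ^ 2 ≤ T)
    (htypeI : ∀ t ∈ Icc 0 T, ∀ x : EuclideanSpace ℝ (Fin 3),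
      ‖u t x‖ ≤ M * (T + τ - t) ^ (-(1 / 2 : ℝ))) :
    ContinuousOn (uncurry (ρ • stPull (ρ ^ 2) ρ T x₀ u)) (Ioo (-Real.exp (2 * K)) 0 ×ˢ univ) ∧
    (∀ s ∈ Ioo (-Real.exp (2 * K)) 0, IsWeaklyDivFree ((ρ • stPull (ρ ^ 2) ρ T x₀ u) s)) ∧
    (∀ σ σ' : ℝ, -Real.exp (2 * K) < σ → σ < σ' → σ' < 0 → ∀ y,
      (ρ • stPull (ρ ^ 2) ρ T x₀ u) σ' y =
        UnboundedOperators.heatExtension ((ρ • stPull (ρ ^ 2) ρ T x₀ u) σ) (σ' - σ) y -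
          oseenDuhamel 1 σ (ρ • stPull (ρ ^ 2) ρ T x₀ u) (ρ • stPull (ρ ^ 2) ρ T x₀ u) σ' y) ∧
    (∀ s ∈ Ioo (-Real.exp (2 * K)) 0, ∀ y,
      Real.sqrt (-s) * ‖(ρ • stPull (ρ ^ 2) ρ T x₀ u) s y‖ ≤ M) := by
  set w := ρ • stPull (ρ ^ 2) ρ T x₀ u with hw
  have hρ2 : 0 < ρ ^ 2 := by positivity
  have hT : 0 < T := lt_of_lt_of_le (by positivity) hlife
  -- times of the zoomed slab land in `[0, T]`
  have hmem : ∀ s ∈ Ioo (-Real.exp (2 * K)) 0, T + ρ ^ 2 * s ∈ Icc 0 T := by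
    intro s hs
    refine ⟨?_, by nlinarith [hs.2]⟩
    have : ρ ^ 2 * (-Real.exp (2 * K)) < ρ ^ 2 * s := mul_lt_mul_of_pos_left hs.1 hρ2
    nlinarith
  -- the zoomed pair is classical on the preimage time set, which contains the open slab
  have hcl : IsClassicalNSSolutionOn ((fun r => T + ρ ^ 2 * r) ⁻¹' Icc 0 T) 1 0 w
      (ρ ^ 2 • stPull (ρ ^ 2) ρ T x₀ p) := hframe.1.nsRescale_translate_zero hρ T x₀
  have hsub : Ioo (-Real.exp (2 * K)) 0 ⊆ (fun r => T + ρ ^ 2 * r) ⁻¹' Icc 0 T :=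
    fun s hs => hmem s hs
  -- `M ≥ 0` (the Type-I clause at `t = 0`)
  have hM : 0 ≤ M := by
    have h := htypeI 0 ⟨le_rfl, hT.le⟩ x₀
    have hpos : 0 < (T + τ - 0) ^ (-(1 / 2 : ℝ)) := Real.rpow_pos_of_pos (by linarith) _
    nlinarith [norm_nonneg (u 0 x₀)]
  refine ⟨(hcl.smooth_velocity.continuousOn).mono (prod_mono hsub Subset.rfl), ?_, ?_, ?_⟩
  · -- weakly divergence free slices
    intro s hs
    exact VectorCalculus.IsDivFree.isWeaklyDivFree_holds (hcl.divFree s (hsub hs))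
      (contDiff_infty.1 (hcl.contDiff_velocity (hsub hs)) 1)
  · -- the Oseen identity, transported from `u` on `[0, T]`
    intro σ σ' hσ hσσ' hσ' y
    -- `u` is bounded on `[0,T]` by the virtual Type-I bound, and has finite energy
    set Mb : ℝ := M * τ ^ (-(1 / 2 : ℝ)) + 1 with hMb
    have hMb_pos : 0 < Mb := by
      have : 0 ≤ M * τ ^ (-(1 / 2 : ℝ)) := mul_nonneg hM (Real.rpow_nonneg hτ.le _)
      linarith
    have hbd : ∀ t ∈ Icc 0 T, ∀ y, ‖u t y‖ ≤ Mb := by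
      intro t ht y
      have h1 := htypeI t ht y
      have hle : (T + τ - t) ^ (-(1 / 2 : ℝ)) ≤ τ ^ (-(1 / 2 : ℝ)) := by
        rw [Real.rpow_neg (by linarith [ht.2]), Real.rpow_neg hτ.le, ← Real.sqrt_eq_rpow,
          ← Real.sqrt_eq_rpow]
        exact inv_anti₀ (Real.sqrt_pos.2 hτ) (Real.sqrt_le_sqrt (by linarith [ht.2]))
      calc ‖u t y‖ ≤ M * (T + τ - t) ^ (-(1 / 2 : ℝ)) := h1
        _ ≤ M * τ ^ (-(1 / 2 : ℝ)) := mul_le_mul_of_nonneg_left hle hM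
        _ ≤ Mb := by rw [hMb]; linarith
    have hE := frame_finite_energy hframe.2
    have hs0 : 0 ≤ T + ρ ^ 2 * σ := (hmem σ ⟨hσ, hσσ'.trans hσ'⟩).1
    have hst : T + ρ ^ 2 * σ < T + ρ ^ 2 * σ' := by nlinarith
    have htT : T + ρ ^ 2 * σ' ≤ T := by nlinarith
    have hrep : ∀ X, u (T + ρ ^ 2 * σ') X =
        UnboundedOperators.heatExtension (u (T + ρ ^ 2 * σ))
          (T + ρ ^ 2 * σ' - (T + ρ ^ 2 * σ)) X -
          oseenDuhamel 1 (T + ρ ^ 2 * σ) u u (T + ρ ^ 2 * σ') X := by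
      intro X
      have h := hframe.1.eq_forced_oseenMild_of_bounded one_pos
        (g := (0 : ℝ → EuclideanSpace ℝ (Fin 3) → EuclideanSpace ℝ (Fin 3)))
        (G := 0) continuous_const (fun _ _ => by simp)
        (fun _ _ => isWeaklyDivFree_zero_field) (G₂ := 0) ENNReal.zero_ne_top
        (fun _ _ => by simp) hE hMb_pos hbd hs0 hst htT X
      rwa [one_mul, forceDuhamel_zero_force, add_zero] at h
    exact oseen_smul_stPull hρ T x₀ hσσ' hrep y
  · -- the rate `√(−s) ‖w(s,y)‖ ≤ M`
    intro s hs y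
    have hs' := hmem s hs
    have h1 := htypeI (T + ρ ^ 2 * s) hs' (x₀ + ρ • y)
    have hns : 0 < -s := neg_pos.2 hs.2
    have hpos : 0 < ρ ^ 2 * (-s) := mul_pos hρ2 hns
    have e : T + τ - (T + ρ ^ 2 * s) = τ + ρ ^ 2 * (-s) := by ring
    rw [e] at h1
    have hle : (τ + ρ ^ 2 * (-s)) ^ (-(1 / 2 : ℝ)) ≤ (ρ * Real.sqrt (-s))⁻¹ := by
      rw [Real.rpow_neg (by positivity), ← Real.sqrt_eq_rpow]
      refine inv_anti₀ (by positivity) ?_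
      have e2 : ρ * Real.sqrt (-s) = Real.sqrt (ρ ^ 2 * (-s)) := by
        rw [Real.sqrt_mul (sq_nonneg ρ), Real.sqrt_sq hρ.le]
      rw [e2]
      exact Real.sqrt_le_sqrt (by linarith)
    have hwn : ‖w s y‖ = ρ * ‖u (T + ρ ^ 2 * s) (x₀ + ρ • y)‖ := by
      rw [hw, smul_stPull_apply, norm_smul, Real.norm_of_nonneg hρ.le]
    have hsq : 0 < Real.sqrt (-s) := Real.sqrt_pos.2 hns
    rw [hwn]
    calc Real.sqrt (-s) * (ρ * ‖u (T + ρ ^ 2 * s) (x₀ + ρ • y)‖)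
        ≤ Real.sqrt (-s) * (ρ * (M * (ρ * Real.sqrt (-s))⁻¹)) := by
          gcongr
          exact h1.trans (mul_le_mul_of_nonneg_left hle hM)
      _ = M := by field_simp


/-! ### Glue for clause (3): a backward singular point of the tree is `SingularAt` of the line -/

/-- The tree's `IsBackwardSingularPoint v (0,0)` (`v` essentially unbounded on every backward
parabolic cylinder `Q((0,0), r) = (−r², 0) × B(0, r)`) implies the line's pointwise `SingularAt v 0`
(for every `r > 0` and every level `A` some point of `(−r², 0) × B(0, r)` has `‖v‖ > A`): a set on
which `‖v‖ ≤ A` everywhere has `L^∞` norm `≤ A < ∞`. No continuity is needed. [folklore] -/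
theorem singularAt_zero_of_isBackwardSingularPoint
    {v : ℝ → EuclideanSpace ℝ (Fin 3) → EuclideanSpace ℝ (Fin 3)}
    (h : IsBackwardSingularPoint v ((0 : ℝ), (0 : EuclideanSpace ℝ (Fin 3)))) : SingularAt v 0 := by
  intro r hr A
  by_contra hno
  push Not at hno
  have hbound : ∀ z ∈ parabolicCylinder r ((0 : ℝ), (0 : EuclideanSpace ℝ (Fin 3))),
      ‖uncurry v z‖ ≤ A := by
    rintro ⟨t, y⟩ hz
    rw [mem_parabolicCylinder] at hz
    obtain ⟨⟨h1, h2⟩, h3⟩ := hz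
    simp only [zero_sub] at h1 h2 h3
    exact hno t ⟨h1, h2⟩ y (mem_ball.2 h3)
  have hle : eLpNorm (uncurry v) ∞
      (volume.restrict (parabolicCylinder r ((0 : ℝ), (0 : EuclideanSpace ℝ (Fin 3))))) ≤
        ENNReal.ofReal A := by
    rw [eLpNorm_exponent_top]
    exact eLpNormEssSup_le_of_ae_bound
      (ae_restrict_of_forall_mem (isOpen_parabolicCylinder _ _).measurableSet hbound)
  rw [h r hr] at hle
  exact absurd hle (by simp)

/-! ### Cheap cascades of every length: the Type-I ancient mild zoom limit -/

/-- **The KNSS half of `stub_thinObjectExtraction`.**  If cheap cascades of every length `K` exist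
for the Type-I constant `M` and the budget `q`, then for SOME choice of cascade witnesses
`(T_K, τ_K, ρ_K, x₀^K, u_K, p_K)` (exported with all their `CheapCascade` clauses) the zooms
`w_K(s,y) = ρ_K u_K(T_K + ρ_K² s, x₀^K + ρ_K y)` converge along a subsequence `φ` — uniformly on the
compact slab pieces `[−(n+2), −1/(n+2)] × B̄(0, n+2)`, pointwise on the open past, and locally uniformly
on every negative time slice — to a field `W` of the tree's class `IsTypeIAncientMild M W` (jointly
smooth on the open past, divergence free, Oseen-mild between all pairs of negative times, rate
`‖W(t,x)‖ ≤ M/√(−t)`).  Proof: `zoom_of_cheapCascade` for every `K`, KNSS 2009 Lemma 6.1 in the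
Type-I-rate form (`KNSS2009_lemma61_typeI_rate`, slabs `(−e^{2K}, 0)`), and the packaging
`isTypeIAncientMild_of_continuous_oseenMild_rate` (KNSS Prop. 4.1 smoothing).
[cite: KochNadirashviliSereginSverak2009, Lemma 6.1 and proof of Thm 6.2 (arXiv:0709.3599 pp. 11–13)] -/
theorem exists_typeIAncientMild_zoomLimit_of_cheapCascades {M q : ℝ}
    (hK : ∀ K : ℕ, CheapCascade M q K) :
    ∃ (T τ ρ : ℕ → ℝ) (x₀ : ℕ → EuclideanSpace ℝ (Fin 3))
      (u : ℕ → ℝ → EuclideanSpace ℝ (Fin 3) → EuclideanSpace ℝ (Fin 3))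
      (p : ℕ → ℝ → EuclideanSpace ℝ (Fin 3) → ℝ)
      (φ : ℕ → ℕ) (W : ℝ → EuclideanSpace ℝ (Fin 3) → EuclideanSpace ℝ (Fin 3)),
      (∀ K : ℕ, TaoFrame (T K) (u K) (p K) ∧ 0 < τ K ∧ 0 < ρ K ∧
        Real.exp (2 * K) * ρ K ^ 2 ≤ T K ∧
        τ K ≤ M ^ 2 * Real.exp (-2 * (K : ℝ)) * ρ K ^ 2 ∧
        (∀ t ∈ Icc 0 (T K), ∀ x : EuclideanSpace ℝ (Fin 3),
          ‖u K t x‖ ≤ M * (T K + τ K - t) ^ (-(1 / 2 : ℝ))) ∧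
        Real.exp K ≤ ρ K * ‖u K (T K) (x₀ K)‖ ∧
        ∀ j : ℕ, 1 ≤ j → j ≤ K →
          ∫⁻ x in {x : EuclideanSpace ℝ (Fin 3) | ρ K < ‖x - x₀ K‖ ∧ ‖x - x₀ K‖ < Real.exp j * ρ K},
              ENNReal.ofReal (‖u K (T K) x‖ ^ 3) ≤ ENNReal.ofReal (q * j)) ∧
      StrictMono φ ∧
      IsTypeIAncientMild M W ∧
      (∀ n : ℕ, TendstoUniformlyOn
        (fun j => uncurry ((ρ (φ j)) • stPull (ρ (φ j) ^ 2) (ρ (φ j)) (T (φ j)) (x₀ (φ j)) (u (φ j))))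
        (uncurry W) atTop
        (Icc (-((n : ℝ) + 2)) (-(1 / ((n : ℝ) + 2))) ×ˢ
          closedBall (0 : EuclideanSpace ℝ (Fin 3)) ((n : ℝ) + 2))) ∧
      (∀ t < 0, ∀ x, Tendsto
        (fun j => ((ρ (φ j)) • stPull (ρ (φ j) ^ 2) (ρ (φ j)) (T (φ j)) (x₀ (φ j)) (u (φ j))) t x)
        atTop (𝓝 (W t x))) ∧
      (∀ t < 0, TendstoLocallyUniformly
        (fun j => ((ρ (φ j)) • stPull (ρ (φ j) ^ 2) (ρ (φ j)) (T (φ j)) (x₀ (φ j)) (u (φ j))) t)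
        (W t) atTop) := by
  choose T τ ρ x₀ u p hdata using hK
  -- the zooms and their slabs
  set w : ℕ → ℝ → EuclideanSpace ℝ (Fin 3) → EuclideanSpace ℝ (Fin 3) :=
    fun K => (ρ K) • stPull (ρ K ^ 2) (ρ K) (T K) (x₀ K) (u K) with hw
  set A : ℕ → ℝ := fun K => -Real.exp (2 * (K : ℝ)) with hA
  have hz := fun K : ℕ =>
    zoom_of_cheapCascade (K := K) (x₀ K) (hdata K).1 (hdata K).2.1 (hdata K).2.2.1 (hdata K).2.2.2.1
      (hdata K).2.2.2.2.2.1
  obtain ⟨φ, W, hφ, hWc, hWdiv, hWrate, hWmild, hunif, hpt, hloc⟩ :=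
    KNSS2009_lemma61_typeI_rate (A := A) (w := w) (C := M) tendsto_neg_exp_two_mul_atBot
      (fun K => (hz K).1) (fun K => (hz K).2.1) (fun K s t hs hst ht x => (hz K).2.2.1 s t hs hst ht x)
      (fun K s hs x => (hz K).2.2.2 s hs x)
  have hrate : HasTypeITimeDecay M W := by
    intro t ht x
    have hs : 0 < Real.sqrt (-t) := Real.sqrt_pos.2 (neg_pos.2 ht)
    rw [le_div_iff₀ hs, mul_comm]
    exact hWrate t ht x
  have hTI : IsTypeIAncientMild M W :=
    LocalTypeIBlowup.isTypeIAncientMild_of_continuous_oseenMild_rate hWc hWdiv hWmild hrate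
  exact ⟨T, τ, ρ, x₀, u, p, φ, W, hdata, hφ, hTI, hunif, hpt, hloc⟩

end Summit.NavierStokesRegularity.NavierStokesRegularity.Theorems.ThinCascade

end
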